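import Mathlib
import HarnessLib.Audit
import Summits.PneNP.PneNP.Theorems.PstarCoreBoundTargets
import Summits.PneNP.PneNP.Theorems.PstarFreshErase

/-!
# The union form of the fresh-partner residual of O2 (ROUND-24, memo §14.3 «UNION FORM», §14.6; ASK T-O2-G (U1/U2/G2/G3))

FRONTIER range-avoidance ladder, rung F-N3, ROUND 24 (cell `pnp-ideate`, planner memo `r24/CORE-BOUND-NOTES.md` §14.3/§14.5/§14.6, ASK T-O2-G of
planner p3 g21, typed sketch `r24/SketchUnion.lean` — definitions and statements VERBATIM; restricted-model proof complexity — nothing here bears on `P`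
versus `NP`).

A fresh AND-type variable `z` (in no output of `J₀`, not touched by `w₂`, never in the first AND slot of a monomial of `w₁`) factors
`w₁ = A + z·B` with `B = [z ∈ C₁] + Σ p_i` LINEAR over the gates `(p_i, z) ∈ G₁`; pointwise `S ≡ w₂ ∧ (A = t₁ ∨ A + B = t₁ + [z ∈ C₁])`, so the
terminal-core conditions split over the two pairs `(A, w₂)` (`x_z = 0`) and `(A + B, w₂)` (`x_z = 1`), which have the SAME monomials.

* `Fresh`, `partA`, `partAB`, `SatPair`, `UnionTerminal` — the setting; `bit_gval_partA`, `bit_gval_partAB` — the factorisation `w₁ = A + z·B`;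
* `sat_split_fresh` — **(U1)** over the equations of any `E ⊆ J₀`: `(w₁, w₂)` solvable ⟺ `(A, w₂)` solvable ∨ `(A + B, w₂)` solvable;
* `UnionFive` (OPEN, `@[conjecture]`: the UNION LEMMA = the fresh part of T-O2-4), `TerminalFiveFresh` (OPEN: its named sub-target of `TerminalFiveA`),
  `terminalFiveFresh_of_unionFive` — **(U2)** the reduction;
* `satPair_of_free_andPair` — **(G2)** an output whose AND pair is private, unread and untouched is droppable (first brick of PLAN B, memo §14.6);
* `TerminalFiveLit` (OPEN, `@[conjecture]`) — **(G3)** the LITERAL/FOREST-partner sub-target of `TerminalFiveA`.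
-/

set_option linter.dupNamespace false -- `Summit.PneNP.PneNP.…`: summit = sub-problem name (D-0017 single-conjunct layout)

open Finset Literature.Computability.Complexity
open scoped symmDiff
open Summit.PneNP.PneNP.Theorems.PstarFibrePolys (bit bit_injective bit_xor)
open Summit.PneNP.PneNP.Theorems.PstarTyped (Typed)
open Summit.PneNP.PneNP.Theorems.PstarSALevel (varSet bdry BoundaryExpanding SimpleOverlap)
open Summit.PneNP.PneNP.Theorems.PstarGapPeeling (eval_update_of_not_mem eval_update_and_pair)
open Summit.PneNP.PneNP.Theorems.PstarGapOneAll (gval)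
open Summit.PneNP.PneNP.Theorems.PstarGConstraint (bit_gval gval_update_of_forall_ne)
open Summit.PneNP.PneNP.Theorems.PstarGraphQuadGapTwoForms (sum_symmDiff_zmod2)
open Summit.PneNP.PneNP.Theorems.PstarCoreBound (XorClosed)
open Summit.PneNP.PneNP.Theorems.PstarChordRepair (IsChord)
open Summit.PneNP.PneNP.Theorems.PstarChordBridgeCotree (Peelable)
open Summit.PneNP.PneNP.Theorems.PstarChordBridgeTools (privs)
open Summit.PneNP.PneNP.Theorems.PstarCoreBoundTargets (Terminal)
open Summit.PneNP.PneNP.Theorems.PstarFreshErase (FreshGate eraseGate)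

namespace Summit.PneNP.PneNP.Theorems.PstarUnion

variable {n m : ℕ}

/-! ## The setting -/

/-- `z` is FRESH for `(J₀; w₁, w₂)`: in no output of `J₀`, untouched by `w₂`, and never in the first AND slot of a monomial of `w₁`
(so every monomial of `w₁` containing `z` is a gate `(p, z)` with `p ≠ z`), distinct `z`-gates having distinct partners (automatic under
`SimpleOverlap`). -/
def Fresh (I : LocalMap 4 n m) (J₀ : Finset (Fin m)) (w₁ w₂ : Finset (Fin n) × Finset (Fin m) × Bool) (z : Fin n) : Prop :=
  (∀ j ∈ J₀, z ∉ varSet I j) ∧ z ∉ w₂.1 ∧ (∀ g ∈ w₂.2.1, I.vars g 2 ≠ z ∧ I.vars g 3 ≠ z) ∧ (∀ g ∈ w₁.2.1, I.vars g 2 ≠ z) ∧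
    (∀ g ∈ w₁.2.1, ∀ g' ∈ w₁.2.1, I.vars g 3 = z → I.vars g' 3 = z → I.vars g 2 = I.vars g' 2 → g = g')

/-- The `z`-free part `A` of `w₁ = A + z·B`. -/
def partA (I : LocalMap 4 n m) (w₁ : Finset (Fin n) × Finset (Fin m) × Bool) (z : Fin n) :
    Finset (Fin n) × Finset (Fin m) × Bool :=
  (w₁.1.erase z, w₁.2.1.filter (fun g => I.vars g 3 ≠ z), w₁.2.2)

/-- The `x_z = 1` specialisation `A + B` of `w₁ = A + z·B`: same monomials as `A`, linear part shifted by the gated partners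
`{p : (p,z) ∈ G₁}` (chord privates may now be read LINEARLY — allowed by privates-unread), target shifted by `[z ∈ C₁]`. -/
def partAB (I : LocalMap 4 n m) (w₁ : Finset (Fin n) × Finset (Fin m) × Bool) (z : Fin n) :
    Finset (Fin n) × Finset (Fin m) × Bool :=
  (symmDiff (w₁.1.erase z) ((w₁.2.1.filter fun g => I.vars g 3 = z).image fun g => I.vars g 2),
   w₁.2.1.filter (fun g => I.vars g 3 ≠ z), xor w₁.2.2 (decide (z ∈ w₁.1)))

/-- Solvability of a G-pair over the equations of `E`. -/
def SatPair (I : LocalMap 4 n m) (y : Fin m → Bool) (E : Finset (Fin m)) (A w₂ : Finset (Fin n) × Finset (Fin m) × Bool) : Prop :=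
  ∃ x : Fin n → Bool, (∀ j ∈ E, I.eval x j = y j) ∧ gval I A.1 A.2.1 x = A.2.2 ∧ gval I w₂.1 w₂.2.1 x = w₂.2.2

/-- The UNION-TERMINAL conditions for abstract data: a core `J₀`, a shared G-constraint `w₂` and two G-constraints `A₀, A₁` WITH THE SAME
MONOMIAL SET: both pairs `(A₀, w₂)`, `(A₁, w₂)` are infeasible over `J₀`, and every member of `J₀` is needed by at least ONE of the two pairs
(`J₀ = P(A₀,w₂) ∪ P(A₁,w₂)`); the linear parts differ only in non-XOR-slot variables of `J₀` (for a fresh `z` the difference is the set of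
gated partners, AND-type by `Typed`).  Neither pair need be minimal on its own. -/
def UnionTerminal (I : LocalMap 4 n m) (r : ℕ) (y : Fin m → Bool) (J₀ : Finset (Fin m))
    (A₀ A₁ w₂ : Finset (Fin n) × Finset (Fin m) × Bool) : Prop :=
  J₀.Nonempty ∧ XorClosed I J₀ ∧ J₀.card < r ∧ A₁.2.1 = A₀.2.1 ∧ Disjoint J₀ A₀.2.1 ∧ Disjoint J₀ w₂.2.1 ∧
  (J₀ ∪ A₀.2.1 ∪ w₂.2.1).card ≤ r ∧ (∀ v ∈ symmDiff A₀.1 A₁.1, ∀ j ∈ J₀, I.vars j 0 ≠ v ∧ I.vars j 1 ≠ v) ∧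
  ¬ SatPair I y J₀ A₀ w₂ ∧ ¬ SatPair I y J₀ A₁ w₂ ∧ (∀ f ∈ J₀, SatPair I y (J₀.erase f) A₀ w₂ ∨ SatPair I y (J₀.erase f) A₁ w₂)

/-- **UNION LEMMA (OPEN; = the fresh-partner part of T-O2-4, memo §14.3):** a union-terminal core whose monomials avoid the private AND variables
of the chords has at most five members.  Known cases: one cover total (then the landed chain `card_le_five_of_terminal` applies to that pair);
`A₁ = A₀ + x_p` for a clean chord private `p` untouched otherwise (FRESH ERASE, `PstarFreshEraseTerminal.terminal_eraseGate`).  FRONTIER. -/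
@[conjecture] def UnionFive : Prop :=
  ∀ (n m r : ℕ) (I : LocalMap 4 n m), I.IsPure xorAndPred → Typed I → SimpleOverlap I → BoundaryExpanding r I →
  ∀ (y : Fin m → Bool) (J₀ : Finset (Fin m)) (A₀ A₁ w₂ : Finset (Fin n) × Finset (Fin m) × Bool),
    UnionTerminal I r y J₀ A₀ A₁ w₂ →
    ∀ F ⊆ J₀, Peelable I F → (∀ F', F ⊆ F' → F' ⊆ J₀ → Peelable I F' → F' = F) → (∀ e ∈ J₀ \ F, IsChord I J₀ e) →
    (∀ g ∈ A₀.2.1 ∪ w₂.2.1, ∀ v ∈ privs I (J₀ \ F), I.vars g 2 ≠ v ∧ I.vars g 3 ≠ v) →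
    J₀.card ≤ 5

/-- **The named sub-target of `TerminalFiveA` it settles (OPEN):** terminal cores all of whose privates-reading monomials are gates on ONE fresh `z`.
FRONTIER. -/
@[conjecture] def TerminalFiveFresh : Prop :=
  ∀ (n m r : ℕ) (I : LocalMap 4 n m), I.IsPure xorAndPred → Typed I → SimpleOverlap I → BoundaryExpanding r I →
  ∀ (y : Fin m → Bool) (J₀ : Finset (Fin m)) (w₁ w₂ : Finset (Fin n) × Finset (Fin m) × Bool) (z : Fin n),
    Terminal I r y J₀ w₁ w₂ → Fresh I J₀ w₁ w₂ z →
    ∀ F ⊆ J₀, Peelable I F → (∀ F', F ⊆ F' → F' ⊆ J₀ → Peelable I F' → F' = F) → (∀ e ∈ J₀ \ F, IsChord I J₀ e) →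
    (∀ g ∈ w₁.2.1 ∪ w₂.2.1, I.vars g 3 ≠ z → ∀ v ∈ privs I (J₀ \ F), I.vars g 2 ≠ v ∧ I.vars g 3 ≠ v) →
    J₀.card ≤ 5

/-- **(G3) The LITERAL-PARTNER sub-target of `TerminalFiveA` (OPEN; residual R1 = T-O2-4 for literal/forest partners; prover-1 O2-SCOPING §8 C1–C4,
suggested rung `direction_coherent_le_five`):** every monomial touching a chord variable is a gate whose OTHER variable is an AND variable of an
`F`-edge (forest / literal partner), and each chord is touched by at most one monomial.  At most `k/3` such gates pass expansion (O2-SCOPING §9 E1);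
the `k = 1` member is certified (`PstarGateUnitBridge.gate_unit_of_dir`).  FRONTIER. -/
@[conjecture] def TerminalFiveLit : Prop :=
  ∀ (n m r : ℕ) (I : LocalMap 4 n m), I.IsPure xorAndPred → Typed I → SimpleOverlap I → BoundaryExpanding r I →
  ∀ (y : Fin m → Bool) (J₀ : Finset (Fin m)) (w₁ w₂ : Finset (Fin n) × Finset (Fin m) × Bool), Terminal I r y J₀ w₁ w₂ →
    ∀ F ⊆ J₀, Peelable I F → (∀ F', F ⊆ F' → F' ⊆ J₀ → Peelable I F' → F' = F) → (∀ e ∈ J₀ \ F, IsChord I J₀ e) →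
    (∀ g ∈ w₁.2.1 ∪ w₂.2.1, ∀ e ∈ J₀ \ F, ∀ s : Fin 4, 2 ≤ s.val → (I.vars g s = I.vars e 2 ∨ I.vars g s = I.vars e 3) →
      (∃ f ∈ F, ∃ s' : Fin 4, 2 ≤ s'.val ∧ s' ≠ s ∧ (I.vars g s' = I.vars f 2 ∨ I.vars g s' = I.vars f 3)) ∧
      (∀ g' ∈ w₁.2.1 ∪ w₂.2.1, g' ≠ g → ∀ s' : Fin 4, 2 ≤ s'.val → I.vars g' s' ≠ I.vars e 2 ∧ I.vars g' s' ≠ I.vars e 3)) →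
    J₀.card ≤ 5

/-! ## The factorisation `w₁ = A + z·B` -/

section Split

variable {I : LocalMap 4 n m} {J₀ : Finset (Fin m)} {w₁ w₂ : Finset (Fin n) × Finset (Fin m) × Bool} {z : Fin n}

/-- the linear form `Σ_{(p,z) ∈ G₁} x_p` of the gated partners -/
def gsum (I : LocalMap 4 n m) (w₁ : Finset (Fin n) × Finset (Fin m) × Bool) (z : Fin n) (x : Fin n → Bool) : ZMod 2 :=
  ∑ g ∈ w₁.2.1.filter (fun g => I.vars g 3 = z), bit (x (I.vars g 2))

/-- **`w₁ = A + x_z·([z ∈ C₁] + Σ p_i)`.** -/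
theorem bit_gval_w₁ (x : Fin n → Bool) :
    bit (gval I w₁.1 w₁.2.1 x) = bit (gval I (partA I w₁ z).1 (partA I w₁ z).2.1 x) +
      bit (x z) * ((if z ∈ w₁.1 then 1 else 0) + gsum I w₁ z x) := by
  classical
  unfold partA gsum
  rw [bit_gval, bit_gval, ← sum_filter_add_sum_filter_not w₁.2.1 (fun g => I.vars g 3 = z)]
  have hlin : ∑ v ∈ w₁.1, bit (x v) = ∑ v ∈ w₁.1.erase z, bit (x v) + if z ∈ w₁.1 then bit (x z) else 0 := by
    by_cases hz : z ∈ w₁.1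
    · rw [if_pos hz, sum_erase_add _ _ hz]
    · rw [if_neg hz, erase_eq_of_notMem hz, add_zero]
  have hgate : ∑ g ∈ w₁.2.1 with I.vars g 3 = z, bit (x (I.vars g 2)) * bit (x (I.vars g 3)) =
      bit (x z) * ∑ g ∈ w₁.2.1 with I.vars g 3 = z, bit (x (I.vars g 2)) := by
    rw [mul_sum]
    exact sum_congr rfl fun g hg => by rw [(mem_filter.1 hg).2, mul_comm]
  rw [hlin, hgate]
  by_cases hz : z ∈ w₁.1
  · simp only [if_pos hz]; ring
  · simp only [if_neg hz]; ring

/-- **`A + B` has linear part `Σ_{A} + Σ p_i`** (the gated partners are distinct). -/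
theorem bit_gval_partAB (hz : Fresh I J₀ w₁ w₂ z) (x : Fin n → Bool) :
    bit (gval I (partAB I w₁ z).1 (partAB I w₁ z).2.1 x) = bit (gval I (partA I w₁ z).1 (partA I w₁ z).2.1 x) + gsum I w₁ z x := by
  classical
  unfold partAB partA gsum
  rw [bit_gval, bit_gval, sum_symmDiff_zmod2, sum_image]
  · ring
  · intro g hg g' hg' h
    exact hz.2.2.2.2 g (mem_filter.1 hg).1 g' (mem_filter.1 hg').1 (mem_filter.1 hg).2 (mem_filter.1 hg').2 h

/-- `A` does not see `z`. -/
theorem gval_partA_update (hz : Fresh I J₀ w₁ w₂ z) (x : Fin n → Bool) (b : Bool) :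
    gval I (partA I w₁ z).1 (partA I w₁ z).2.1 (Function.update x z b) = gval I (partA I w₁ z).1 (partA I w₁ z).2.1 x := by
  unfold partA
  exact gval_update_of_forall_ne I x (notMem_erase z _)
    (fun g hg => ⟨hz.2.2.2.1 g (mem_filter.1 hg).1, (mem_filter.1 hg).2⟩) b

/-- The gated partners do not see `z`. -/
theorem gsum_update (hz : Fresh I J₀ w₁ w₂ z) (x : Fin n → Bool) (b : Bool) : gsum I w₁ z (Function.update x z b) = gsum I w₁ z x := by
  unfold gsum
  exact sum_congr rfl fun g hg => by rw [Function.update_of_ne (hz.2.2.2.1 g (mem_filter.1 hg).1)]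

/-- `w₂` does not see `z`. -/
theorem gval₂_update (hz : Fresh I J₀ w₁ w₂ z) (x : Fin n → Bool) (b : Bool) :
    gval I w₂.1 w₂.2.1 (Function.update x z b) = gval I w₂.1 w₂.2.1 x :=
  gval_update_of_forall_ne I x hz.2.1 hz.2.2.1 b

/-- The outputs of `J₀` do not see `z`. -/
theorem eval_update (hz : Fresh I J₀ w₁ w₂ z) {j : Fin m} (hj : j ∈ J₀) (x : Fin n → Bool) (b : Bool) :
    I.eval (Function.update x z b) j = I.eval x j :=
  eval_update_of_not_mem I j x (hz.1 j hj) b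

end Split

/-! ## (U1) The union split -/

/-- **(U1) UNION SPLIT** of solvability over the equations of any `E ⊆ J₀`: `x_z` is a free knob, so `(w₁, w₂)` is solvable iff the
`x_z = 0` pair `(A, w₂)` is or the `x_z = 1` pair `(A + B, w₂)` is (pure algebra over `gval`). -/
theorem sat_split_fresh (I : LocalMap 4 n m) {J₀ E : Finset (Fin m)} (hE : E ⊆ J₀) (y : Fin m → Bool)
    {w₁ w₂ : Finset (Fin n) × Finset (Fin m) × Bool} {z : Fin n} (hz : Fresh I J₀ w₁ w₂ z) :
    (∃ x : Fin n → Bool, (∀ j ∈ E, I.eval x j = y j) ∧ gval I w₁.1 w₁.2.1 x = w₁.2.2 ∧ gval I w₂.1 w₂.2.1 x = w₂.2.2) ↔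
    ((∃ x : Fin n → Bool, (∀ j ∈ E, I.eval x j = y j) ∧
        gval I (partA I w₁ z).1 (partA I w₁ z).2.1 x = (partA I w₁ z).2.2 ∧ gval I w₂.1 w₂.2.1 x = w₂.2.2) ∨
     (∃ x : Fin n → Bool, (∀ j ∈ E, I.eval x j = y j) ∧
        gval I (partAB I w₁ z).1 (partAB I w₁ z).2.1 x = (partAB I w₁ z).2.2 ∧ gval I w₂.1 w₂.2.1 x = w₂.2.2)) := by
  classical
  have hA2 : (partA I w₁ z).2.2 = w₁.2.2 := rfl
  have hAB2 : (partAB I w₁ z).2.2 = xor w₁.2.2 (decide (z ∈ w₁.1)) := rfl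
  have hdec : bit (decide (z ∈ w₁.1)) = if z ∈ w₁.1 then 1 else 0 := by
    by_cases h : z ∈ w₁.1 <;> simp [h, bit]
  constructor
  · rintro ⟨x, hx, h1, h2⟩
    have hw := bit_gval_w₁ (I := I) (w₁ := w₁) (z := z) x
    rw [h1] at hw
    by_cases hxz : x z = true
    · refine Or.inr ⟨x, hx, ?_, h2⟩
      apply bit_injective
      rw [bit_gval_partAB hz, hAB2, bit_xor, hdec, hw, hxz, show bit true = (1 : ZMod 2) from rfl, one_mul]
      generalize bit (gval I (partA I w₁ z).1 (partA I w₁ z).2.1 x) = a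
      generalize gsum I w₁ z x = s
      generalize (if z ∈ w₁.1 then (1 : ZMod 2) else 0) = c
      revert a s c; decide
    · refine Or.inl ⟨x, hx, ?_, h2⟩
      apply bit_injective
      rw [Bool.eq_false_iff.2 hxz] at hw
      rw [hA2, hw]
      simp [bit]
  · rintro (⟨x, hx, h1, h2⟩ | ⟨x, hx, h1, h2⟩)
    · refine ⟨Function.update x z false, fun j hj => by rw [eval_update hz (hE hj)]; exact hx j hj, ?_,
        by rw [gval₂_update hz]; exact h2⟩
      apply bit_injective
      rw [bit_gval_w₁ (z := z), gval_partA_update hz, h1, hA2, Function.update_self]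
      simp [bit]
    · refine ⟨Function.update x z true, fun j hj => by rw [eval_update hz (hE hj)]; exact hx j hj, ?_,
        by rw [gval₂_update hz]; exact h2⟩
      apply bit_injective
      have hab := bit_gval_partAB hz x
      rw [h1, hAB2, bit_xor, hdec] at hab
      rw [bit_gval_w₁ (z := z), gval_partA_update hz, gsum_update hz, Function.update_self]
      simp only [bit, if_true, one_mul]
      -- `A x = t₁ + c + S`, so `A + (c + S) = t₁`
      have e : ∀ a t c s : ZMod 2, t + c = a + s → a + (c + s) = t := by decide
      exact e _ _ _ _ (by simpa [bit] using hab)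

/-! ## (U2) The reduction to the union lemma -/

/-- **(U2)** `Terminal` for `(w₁, w₂)` with a fresh `z` gives `UnionTerminal` for `(partA w₁ z, partAB w₁ z, w₂)`; hence the union lemma settles
`TerminalFiveFresh`. -/
theorem terminalFiveFresh_of_unionFive : UnionFive → TerminalFiveFresh := by
  intro hU n m r I hI hT hS hB y J₀ w₁ w₂ z ht hz F hF hP hmax hchord hun
  classical
  obtain ⟨hne, hX, hJr, hd₁, hd₂, hr, hT3, hM0⟩ := ht
  have hsub : (partA I w₁ z).2.1 ⊆ w₁.2.1 := filter_subset _ _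
  refine hU n m r I hI hT hS hB y J₀ (partA I w₁ z) (partAB I w₁ z) w₂ ⟨hne, hX, hJr, rfl, hd₁.mono_right hsub, hd₂,
    (card_le_card (union_subset_union (union_subset_union (Subset.refl J₀) hsub) (Subset.refl _))).trans hr, ?_, ?_, ?_, ?_⟩
    F hF hP hmax hchord ?_
  · -- the linear parts differ by the gated partners: AND-slot variables
    intro v hv j hj
    have hv' : v ∈ (w₁.2.1.filter fun g => I.vars g 3 = z).image fun g => I.vars g 2 := by
      unfold partA partAB at hv
      simpa [symmDiff_symmDiff_cancel_left] using hv
    obtain ⟨g, -, rfl⟩ := mem_image.1 hv'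
    exact ⟨hT j g 0 2 (by decide) (by decide), hT j g 1 2 (by decide) (by decide)⟩
  · intro h
    exact hT3 ((sat_split_fresh I (Subset.refl J₀) y hz).2 (Or.inl h))
  · intro h
    exact hT3 ((sat_split_fresh I (Subset.refl J₀) y hz).2 (Or.inr h))
  · intro f hf
    exact (sat_split_fresh I (erase_subset f J₀) y hz).1 (hM0 f hf)
  · intro g hg v hv
    rcases mem_union.1 hg with h | h
    · exact hun g (mem_union_left _ (mem_filter.1 h).1) (mem_filter.1 h).2 v hv
    · exact hun g (mem_union_right _ h) (hz.2.2.1 g h).2 v hv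

/-! ## (G2) Free monomials are droppable -/

/-- **(G2) FREE MONOMIALS ARE DROPPABLE** (pure logic, no expansion): if the AND pair of `f ∈ M` is private to `f` inside `M`, distinct, read by
neither linear part and touched by no monomial of the two constraints, then solvability over `M.erase f` gives solvability over `M` (set the
pair last to match `f`'s equation; nothing else moves).  Hence every member of a minimal infeasible family has a CONTROLLED AND variable —
the z-free content of "tips are read / no free leaf" (memo §14.6 T1–T2) and of "every chord is read". -/
theorem satPair_of_free_andPair (I : LocalMap 4 n m) (hI : I.IsPure xorAndPred) (y : Fin m → Bool) {M : Finset (Fin m)}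
    {A w : Finset (Fin n) × Finset (Fin m) × Bool} {f : Fin m} (hf : f ∈ M) (_hne : I.vars f 2 ≠ I.vars f 3)
    (hpriv : ∀ s : Fin 4, 2 ≤ s.val → ∀ j ∈ M, j ≠ f → I.vars f s ∉ varSet I j)
    (_hxor : ∀ s : Fin 4, 2 ≤ s.val → I.vars f s ≠ I.vars f 0 ∧ I.vars f s ≠ I.vars f 1)
    (hlin : ∀ s : Fin 4, 2 ≤ s.val → I.vars f s ∉ A.1 ∧ I.vars f s ∉ w.1)
    (hmono : ∀ g ∈ A.2.1 ∪ w.2.1, ∀ s s' : Fin 4, 2 ≤ s.val → 2 ≤ s'.val → I.vars g s' ≠ I.vars f s)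
    (h : SatPair I y (M.erase f) A w) : SatPair I y M A w := by
  obtain ⟨x, hx, hA, hw⟩ := h
  -- set both AND variables of `f` to `c := x_u + x_v + y_f`
  set c : Bool := xor (xor (x (I.vars f 0)) (x (I.vars f 1))) (y f) with hc
  have hG : ∀ s : Fin 4, 2 ≤ s.val → (∀ g ∈ A.2.1, I.vars g 2 ≠ I.vars f s ∧ I.vars g 3 ≠ I.vars f s) ∧
      (∀ g ∈ w.2.1, I.vars g 2 ≠ I.vars f s ∧ I.vars g 3 ≠ I.vars f s) := fun s hs =>
    ⟨fun g hg => ⟨hmono g (mem_union_left _ hg) s 2 hs (by decide), hmono g (mem_union_left _ hg) s 3 hs (by decide)⟩,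
     fun g hg => ⟨hmono g (mem_union_right _ hg) s 2 hs (by decide), hmono g (mem_union_right _ hg) s 3 hs (by decide)⟩⟩
  refine ⟨Function.update (Function.update x (I.vars f 2) c) (I.vars f 3) c, fun j hj => ?_, ?_, ?_⟩
  · by_cases hjf : j = f
    · subst hjf
      rw [eval_update_and_pair I hI x j c, hc]
      generalize x (I.vars j 0) = a; generalize x (I.vars j 1) = b; generalize y j = t
      revert a b t; decide
    · rw [eval_update_of_not_mem I j _ (hpriv 3 (by decide) j hj hjf), eval_update_of_not_mem I j _ (hpriv 2 (by decide) j hj hjf)]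
      exact hx j (mem_erase.2 ⟨hjf, hj⟩)
  · rw [gval_update_of_forall_ne I _ (hlin 3 (by decide)).1 (hG 3 (by decide)).1,
      gval_update_of_forall_ne I _ (hlin 2 (by decide)).1 (hG 2 (by decide)).1]
    exact hA
  · rw [gval_update_of_forall_ne I _ (hlin 3 (by decide)).2 (hG 3 (by decide)).2,
      gval_update_of_forall_ne I _ (hlin 2 (by decide)).2 (hG 2 (by decide)).2]
    exact hw

end Summit.PneNP.PneNP.Theorems.PstarUnion
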